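import Literature.AlgebraicGeometry.Resolution.ProjectiveStrongResolution
import Literature.AlgebraicGeometry.Resolution.EquivariantProjectiveResolution
import HarnessLib

/-!
# Equivariant strong embedded resolution: the swallowing mechanism over a prescribed open, with a group action (Kollár 2007, Thm. 3.27 ∕ 3.36 (1)(2)(4))

Topic: `Literature/AlgebraicGeometry/Resolution`. Theorems only (no definition, no named fact).

J. Kollár, *Lectures on Resolution of Singularities* (2007), Thm. 3.36: «(1) `X_r` is smooth. (2) `Π : X_r → X` is
an isomorphism over the smooth locus `X^{ns}`. … (4) `𝓑𝓡` commutes with smooth morphisms», and §3.4.1 (p. 121):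
«any group action on `X` lifts to `X′`». The tree proves (1)(2) over a prescribed open of `ℙⁿ_K`
(`Kollar2007.exists_isResolution_isProjectiveOver_isIso_proj`, `ProjectiveStrongResolution.lean`) and (1)(4) in
embedded form (`exists_equivariant_projective_resolution`, `EquivariantProjectiveResolution.lean`) — but for TWO
resolutions obtained from two existential eliminations of the functor of Thm. 3.69. Consumers (the equivariant smooth
projective model of an étale chart: `Q8Family.exists_genericModel_of_surfaceLifting`,
`HodgeTheory/QuaternionicQuarticGenericModelOfLifting.lean`) need (1)(2)(4) for ONE resolution. This file runs both
arguments over the SAME value `𝓑𝓜𝓞_1(ℙⁿ_K, 𝓘_Z, ∅)`: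

* `exists_isResolution_subschemeι_of_isEmbeddedTransform_isIso` — the strong extraction
  (`exists_isResolution_of_isEmbeddedTransform_isIso`) with its witness exposed (the reduced strict transform);
* `CentreSeq.exists_equivariant_embeddedTransform_of_isExtensionOfSingle` — the mechanism
  `CentreSeq.exists_isEmbeddedTransform_of_isExtensionOfSingle` (centres off the prescribed open until the swallowing
  blow-up) carrying a group action along (`CentreSeq.centre_stable_of_cons_eq_comap`, `IsBlowup.liftAction`,
  `preimage_strictTransformStep_eq` of `BlowupSequencesStableCentres.lean`);
* the assembly over `ℙⁿ_K` (Kollár 3.36 (1)(2)(4) for ONE resolution of a `G`-stable `Z ⊂ ℙⁿ_K`) is the sibling file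
  `EquivariantStrongProjectiveResolution.lean` (`Kollar2007.exists_equivariant_isResolution_isProjectiveOver_isIso_proj`).

Route note: brick «B4» (mechanism half) of the Kollár-free deck family (P-3′) for route `HodgeConjecture/Q8SymplecticPowers` (crux
K1Q, stmt-HodgeConjecture-24190). What remains for the hypothesis `H` of `exists_genericModel_of_surfaceLifting` is
only B3: a `Q₈`-equivariant closed immersion of the generic model (or of the regular affine chart, with linear
action) into some `ℙⁿ_K` with the action extending to `ℙⁿ_K` over `K`, the chart landing in a prescribed `O`.
Nothing here bears on HC.

## References

* [Kollar2007] J. Kollár, Lectures on Resolution of Singularities (2007), Thm. 3.27 (p. 126), Thm. 3.36 (p. 132),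
  3.34.1 (p. 131), §3.4.1 (p. 121), Thm. 3.69 (p. 150).
* [BierstoneGrigorievMilmanWlodarczyk2011] E. Bierstone, D. Grigoriev, P. Milman, J. Włodarczyk, Effective Hironaka
  resolution and its complexity, Asian J. Math. 15 (2011), Thm. 2.0.2 (2)–(3), §3.3, Thm. 8.0.5 (2).
* [Hironaka1964] H. Hironaka, Ann. of Math. 79 (1964), Main Theorem I.
-/

noncomputable section

open CategoryTheory CategoryTheory.Limits AlgebraicGeometry TopologicalSpace Topology

namespace Literature.AlgebraicGeometry.Resolution

universe u

/-! ## The strong extraction with its witness exposed -/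

open Scheme.IdealSheafData in
/-- **Embedded desingularization ⇒ resolution, remembering the isomorphism locus, witness exposed** (the statement
of `exists_isResolution_of_isEmbeddedTransform_isIso` naming the resolution: the REDUCED strict transform
`(𝓘_{closure Y'})_red ↪ X'` maps to `Y` by a resolution `ρ`, `ρ ≫ ι = ι_red ≫ σ`, which is an isomorphism over
`ι⁻¹(V)` for an open `V ⊇ X ∖ T` over which `σ` is an isomorphism). Proof verbatim that of
`exists_isResolution_of_isEmbeddedTransform_isIso`. [cite: BierstoneGrigorievMilmanWlodarczyk2011, §3.3 (3)⇒(4) and Thm. 2.0.3]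
[cite: Kollar2007, proof of Cor. 3.22 (pp. 124–125) and Thm. 3.27 (p. 126)] -/
theorem exists_isResolution_subschemeι_of_isEmbeddedTransform_isIso {X Y X' : Scheme.{u}}
    [IsLocallyNoetherian X] [IsIntegral Y] (ι : Y ⟶ X) [IsClosedImmersion ι] {T : Set X}
    (hT : ι (genericPoint Y) ∉ T) {σ : X' ⟶ X} {Y' : Set X'}
    (h : IsEmbeddedTransform (Set.range ι) T σ Y')
    (hreg : Scheme.IsRegular
      (vanishingIdeal (⟨closure Y', isClosed_closure⟩ : Closeds X')).subscheme) :
    ∃ ρ : (vanishingIdeal (⟨closure Y', isClosed_closure⟩ : Closeds X')).subscheme ⟶ Y,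
      IsResolution ρ ∧
        ρ ≫ ι = (vanishingIdeal (⟨closure Y', isClosed_closure⟩ : Closeds X')).subschemeι ≫ σ ∧
        ∃ V : X.Opens, Tᶜ ⊆ (V : Set X) ∧ IsIso (ρ ∣_ ι ⁻¹ᵁ V) := by
  classical
  -- `ι(Y)` is the closure of the image `ξ` of the generic point of `Y`
  set ξ : X := ι (genericPoint Y) with hξdef
  have hgen : IsGenericPoint ξ (Set.range ι) := by
    have := (genericPoint_spec Y).image ι.continuous
    rwa [Set.image_univ, ι.isClosedEmbedding.isClosed_range.closure_eq] at this
  have hYξ : Set.range ι = closure {ξ} := hgen.symm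
  rw [hYξ] at h
  obtain ⟨hσ, V, hTV, hiso, ξ', hξ', hY'⟩ := h.isProper_and_exists stacks02NS_holds hT
  -- the strict transform `Z = closure {ξ'}` and its reduced structure
  set Z : Closeds X' := ⟨closure Y', isClosed_closure⟩ with hZdef
  have hZ : (Z : Set X') = closure {ξ'} := by
    change closure Y' = closure {ξ'}
    rw [hY', closure_closure]
  let j := (vanishingIdeal Z).subschemeι
  haveI : IsIntegral (vanishingIdeal Z).subscheme :=
    isIntegral_subscheme_vanishingIdeal Z (hZ ▸ isIrreducible_singleton.closure)
  have hrange : Set.range j = closure {ξ'} := by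
    rw [range_subschemeι, coe_support_vanishingIdeal, hZ]
  -- `σ ∘ j` factors through `ι`
  have hker : ι.ker ≤ (j ≫ σ).ker := by
    have e1 : (j ≫ σ).ker = vanishingIdeal (.closure (σ '' (Z : Set X'))) := by
      rw [← map_vanishingIdeal]
      rfl
    rw [e1, ← le_support_iff_le_vanishingIdeal]
    have e2 : (ι.ker.support : Set X) = Set.range ι := by
      rw [Scheme.Hom.support_ker, ι.isClosedEmbedding.isClosed_range.closure_eq]
    rw [← SetLike.coe_subset_coe, e2, Closeds.closure]
    change closure (σ '' (Z : Set X')) ⊆ Set.range ι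
    rw [hYξ, hZ]
    refine closure_minimal ((image_closure_subset_closure_image σ.continuous).trans ?_)
      isClosed_closure
    rw [Set.image_singleton, hξ']
  let ρ : (vanishingIdeal Z).subscheme ⟶ Y := IsClosedImmersion.lift ι (j ≫ σ) hker
  have hρ : ρ ≫ ι = j ≫ σ := IsClosedImmersion.lift_fac ι (j ≫ σ) hker
  have hρapp : ∀ y, ι (ρ y) = σ (j y) := fun y => by
    rw [← Scheme.Hom.comp_apply, hρ, Scheme.Hom.comp_apply]
  -- properness
  haveI : IsProper ρ := by
    have : IsProper (ρ ≫ ι) := by rw [hρ]; infer_instance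
    exact MorphismProperty.of_postcomp (W := @IsProper) (W' := @IsSeparated) ρ ι inferInstance
      this
  -- the dense open `U = ι⁻¹ V` of `Y` and the point `y₀` over `ξ'`
  let U : Y.Opens := ι ⁻¹ᵁ V
  have hξV : ξ ∈ V := hTV hT
  have hηU : genericPoint Y ∈ U := hξV
  obtain ⟨y₀, hy₀⟩ : ξ' ∈ Set.range j := by rw [hrange]; exact subset_closure rfl
  have hfibξ : σ ⁻¹' {ξ} = {ξ'} := by
    obtain ⟨x, -, huniq⟩ := existsUnique_preimage_of_isIso_morphismRestrict σ hiso hξV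
    ext z
    simp only [Set.mem_preimage, Set.mem_singleton_iff]
    exact ⟨fun hz => (huniq z hz).trans (huniq ξ' hξ').symm, fun hz => hz ▸ hξ'⟩
  -- points of `X'` over `ι(Y) ∩ V` lie in the strict transform
  have hover : ∀ x : X', σ x ∈ Set.range ι → σ x ∈ V → x ∈ closure {ξ'} := by
    intro x hx hxV
    rw [hYξ] at hx
    have := preimage_closure_inter_subset_of_isIso_morphismRestrict σ hiso {ξ} ⟨hx, hxV⟩
    rwa [hfibξ] at this
  -- over `U`, `ρ` is a surjective closed immersion onto a reduced scheme, hence an isomorphism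
  have hisoU : IsIso (ρ ∣_ U) := by
    haveI : IsClosedImmersion (ρ ∣_ U) := by
      have h1 : IsClosedImmersion ((j ≫ σ) ∣_ V) := by
        rw [morphismRestrict_comp]
        haveI := hiso
        exact (MorphismProperty.cancel_right_of_respectsIso @IsClosedImmersion _ _).mpr
          (IsZariskiLocalAtTarget.restrict (inferInstanceAs (IsClosedImmersion j)) _)
      rw [← hρ, morphismRestrict_comp] at h1
      exact MorphismProperty.of_postcomp (W := @IsClosedImmersion) (W' := @IsSeparated)
        (ρ ∣_ U) (ι ∣_ V) inferInstance h1
    haveI : Surjective (ρ ∣_ U) := by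
      refine ⟨fun u => ?_⟩
      have hu : ι u.1 ∈ V := u.2
      obtain ⟨x, hx, -⟩ := existsUnique_preimage_of_isIso_morphismRestrict σ hiso hu
      have hxZ : x ∈ Set.range j := by
        rw [hrange]
        exact hover x (hx ▸ Set.mem_range_self _) (hx ▸ hu)
      obtain ⟨y₁, rfl⟩ := hxZ
      have hρy₁ : ρ y₁ = u.1 := ι.isClosedEmbedding.injective (by rw [hρapp, hx])
      refine ⟨⟨y₁, show ρ y₁ ∈ U by rw [hρy₁]; exact u.2⟩, Subtype.ext ?_⟩
      rw [morphismRestrict_base_coe]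
      exact hρy₁
    exact isIso_of_isClosedImmersion_of_surjective _
  have hbir : IsBirational ρ := by
    refine ⟨U, ?_, ?_, hisoU⟩
    · have hd : Dense ({genericPoint Y} : Set Y) := by
        rw [dense_iff_closure_eq]; exact genericPoint_spec Y
      exact hd.mono (Set.singleton_subset_iff.mpr hηU)
    · have hgen' : closure ({y₀} : Set (vanishingIdeal Z).subscheme) = Set.univ := by
        rw [j.isClosedEmbedding.isInducing.closure_eq_preimage_closure_image, Set.image_singleton,
          hy₀, ← hrange, Set.preimage_range]
      have hd : Dense ({y₀} : Set (vanishingIdeal Z).subscheme) := by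
        rw [dense_iff_closure_eq]; exact hgen'
      refine hd.mono (Set.singleton_subset_iff.mpr ?_)
      change ι (ρ y₀) ∈ V
      rw [hρapp, hy₀, hξ']
      exact hξV
  exact ⟨ρ, ⟨inferInstance, hbir, hreg⟩, hρ, V, hTV, hisoU⟩

/-! ## Centres off the prescribed open until the swallowing blow-up — with a group action -/

namespace CentreSeq

variable {G : Type*} [Group G]

/-- **The mechanism of `CentreSeq.exists_isEmbeddedTransform_of_isExtensionOfSingle`, carrying a group action.**
Same hypotheses (`A` locally Noetherian, `ξ ∈ A`, `T ⊆ A` with `ξ ∉ T`, `U₀` with `A ∖ U₀ ⊆ T`; an embedded transform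
`π : X → A` of `closure {ξ}` over `T` with strict transform `Yx`; an open immersion `j : U → X` covering `π⁻¹(U₀)`;
an ideal sheaf `J` on `U` vanishing at a point over `ξ`; a marked ideal `Mx = (X, 𝓘, E, 1)` with
`V(𝓘) ⊆ π⁻¹(closure {ξ})`; `s` admissible for `Mx` whose restriction to `U` is an extension of the single blow-up of
`J`) PLUS actions `ρ₀` of `G` on `A` and `ρ` on `X` with `π` equivariant, `Yx` stable and `s = (ρ g)^* s`. THEN the
initial segment produced there (an embedded transform `σ : X' → A` of `closure {ξ}` over `T` whose reduced strict
transform is regular) carries an action `ρ''` of `G` over `ρ₀` stabilising the strict transform.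
[cite: BierstoneGrigorievMilmanWlodarczyk2011, Thm. 2.0.2 (2)–(3) via Thm. 8.0.5 (2)] [cite: Kollar2007, §3.4.1 (p. 121)] -/
theorem exists_equivariant_embeddedTransform_of_isExtensionOfSingle {A : Scheme.{u}} [IsLocallyNoetherian A]
    {ξ : A} {T : Set A} (hξT : ξ ∉ T) {U₀ : Set A} (hU₀T : U₀ᶜ ⊆ T) (ρ₀ : G →* Aut A) :
    ∀ {X : Scheme.{u}} (s : CentreSeq X) (π : X ⟶ A) (Yx : Set X),
      IsEmbeddedTransform (closure {ξ}) T π Yx →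
      ∀ {U : Scheme.{u}} (j : U ⟶ X) [IsOpenImmersion j], π ⁻¹' U₀ ⊆ Set.range j →
      ∀ (J : U.IdealSheafData), (∃ u : U, u ∈ J.support ∧ π (j u) = ξ) →
      ∀ (Mx : MarkedIdeal X), Mx.mult = 1 → (Mx.ideal.support : Set X) ⊆ π ⁻¹' closure {ξ} →
        s.IsAdmissibleFor Mx → (s.restrict j).IsExtensionOfSingle J →
      ∀ ρ : G →* Aut X, (∀ g : G, (ρ g).hom ≫ π = π ≫ (ρ₀ g).hom) → (∀ g : G, (ρ g).hom ⁻¹' Yx = Yx) →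
        (∀ g : G, s = s.comap (ρ g).hom) →
        ∃ (X' : Scheme.{u}) (σ : X' ⟶ A) (Y' : Set X') (ρ'' : G →* Aut X'),
          IsEmbeddedTransform (closure {ξ}) T σ Y' ∧
            Scheme.IsRegular (Scheme.IdealSheafData.vanishingIdeal
              (⟨closure Y', isClosed_closure⟩ : Closeds X')).subscheme ∧
            (∀ g : G, (ρ'' g).hom ≫ σ = σ ≫ (ρ₀ g).hom) ∧ (∀ g : G, (ρ'' g).hom ⁻¹' Y' = Y')
  | _, nil _, _, _, _, _, _, _, _, _, _, _, _, _, _, hext, _, _, _, _ => (hext : False).elim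
  | X, cons C rest, π, Yx, hET, U, j, _, hj, J, hJ, Mx, hμ, hV, hadm, hext, ρ, hρπ, hρY, hρs => by
    obtain ⟨hCsupp, -, hC, hrest⟩ := hadm
    -- the centre lies over `V(𝓘) ⊆ closure {ξ}`
    have hCV : (C.support : Set X) ⊆ π ⁻¹' closure {ξ} :=
      (hCsupp.trans (Mx.support_subset_support_ideal (by omega))).trans hV
    have hCY : π '' (C.support : Set X) ⊆ closure {ξ} := Set.image_subset_iff.mpr hCV
    -- membership in the restricted centre
    have hmem : ∀ u : U, u ∈ (C.comap j).support ↔ j u ∈ C.support := fun u => by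
      rw [Scheme.IdealSheafData.support_comap]
      rfl
    -- the centre is `ρ`-stable
    have hCstab : ∀ g : G, C.comap (ρ g).hom = C := fun g =>
      (centre_stable_of_cons_eq_comap (ρ g).hom (hρs g)).1
    rcases hext with ⟨hCJ, -⟩ | ⟨hCtop, hrest'⟩
    · -- the `J`-step: the centre passes through the point over `ξ` and swallows `Yx`; stop here
      obtain ⟨u, huJ, hu⟩ := hJ
      have huC : j u ∈ C.support := (hmem u).mp (hCJ ▸ huJ)
      exact ⟨X, π, Yx, ρ, hET, hET.isRegular_subscheme_of_centre hξT C hC hCY ⟨j u, huC, hu⟩, hρπ, hρY⟩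
    · -- a step trivial over `U`: its centre misses `π⁻¹(U₀)`, hence lies over `T`; continue equivariantly
      have hT : π '' (C.support : Set X) ⊆ T := by
        rintro _ ⟨x, hxC, rfl⟩
        refine hU₀T fun hxU₀ => ?_
        obtain ⟨u, hux⟩ := hj hxU₀
        have : u ∈ (C.comap j).support := (hmem u).mpr (hux ▸ hxC)
        rw [hCtop, Scheme.IdealSheafData.support_top] at this
        exact this
      have hτ : IsBlowup (blowup.π C) C := blowup.isBlowup C
      have hET' := IsEmbeddedTransform.blowup hET C (blowup.π C) hτ hC hT
      -- the blow-up of `U` along `j^*C = ⊤` is an isomorphism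
      have hcart : IsEffectiveCartier (C.comap j) := by
        rw [hCtop]
        exact isEffectiveCartier_top
      haveI : IsIso (blowup.π (C.comap j)) := (blowup.isBlowup (C.comap j)).isIso hcart
      -- the lifted action on the blow-up
      let ρ₁ : G →* Aut (blowup C) := hτ.liftAction ρ hCstab
      have hρ₁τ : ∀ g : G, (ρ₁ g).hom ≫ blowup.π C = blowup.π C ≫ (ρ g).hom := fun g =>
        hτ.liftAction_hom_comp ρ hCstab g
      have hρ₁s : ∀ g : G, rest = rest.comap (ρ₁ g).hom := by
        obtain ⟨hC', h'⟩ := eq_comap_liftAction_of_cons_eq_comap ρ hρs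
        exact h'
      refine exists_equivariant_embeddedTransform_of_isExtensionOfSingle hξT hU₀T ρ₀ rest
        (blowup.π C ≫ π) _ hET' (blowup.map C j) ?_ (J.comap (blowup.π (C.comap j))) ?_
        (Mx.transform (blowup.π C) C) (by simpa using hμ) ?_ hrest hrest' ρ₁ ?_ ?_ hρ₁s
      · -- `(π ∘ σ_C)⁻¹ U₀ ⊆ range Bl(j)`
        intro x hx
        rw [blowup.range_map]
        exact hj hx
      · -- the point over `ξ` persists in `V(J')`, `J'` the pull-back of `J`
        obtain ⟨u, huJ, hu⟩ := hJ
        refine ⟨inv (blowup.π (C.comap j)) u, ?_, ?_⟩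
        · rw [Scheme.IdealSheafData.support_comap]
          show blowup.π (C.comap j) (inv (blowup.π (C.comap j)) u) ∈ J.support
          rwa [← Scheme.Hom.comp_apply, IsIso.inv_hom_id]
        · rw [Scheme.Hom.comp_apply, ← Scheme.Hom.comp_apply _ (blowup.π C), blowup.map_π,
            Scheme.Hom.comp_apply, ← Scheme.Hom.comp_apply _ (blowup.π (C.comap j)),
            IsIso.inv_hom_id]
          exact hu
      · -- `V(𝓘') ⊆ σ_C⁻¹ V(𝓘)`: the controlled transform contains the total transform
        intro x hx
        have hx' := Scheme.IdealSheafData.support_antitone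
          (comap_le_controlledTransform (blowup.π C) C Mx.ideal Mx.mult) hx
        rw [Scheme.IdealSheafData.support_comap] at hx'
        exact hV hx'
      · intro g
        rw [← Category.assoc, hρ₁τ g, Category.assoc, hρπ g, Category.assoc]
      · intro g
        exact preimage_strictTransformStep_eq (ρ g).hom (hCstab g) (blowup.π C) (hρ₁τ g) (hρY g)

end CentreSeq

end Literature.AlgebraicGeometry.Resolution

end
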